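import Mathlib
import Summits.Ventures.HodgeRepro.Tier4.Common.CompactUnimodular
import Summits.Ventures.HodgeRepro.Tier4.Common.KTypeProjector

/-!
# Tier4/Common/KTypeProjectorAdjoint — the `(C, χ)`-projector is SELF-ADJOINT for the `L²(Γ\G)` pairing over a
fundamental domain, and VANISHES on the orthogonal complement of its image: `⟨ψ, e ψ⟩_D = 0 ⇒ e ψ = 0 a.e. ⇒
R(f) ψ = 0` for every right-`(C, χ̄)`-equivariant test function `f`

Blind re-derivation cell `pub-hodge-repro`, Tier 4 «prove the step» (README §9–§10), seat t4-typer-2 (gen 3).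
Target tree path `lean/Summits/Ventures/HodgeRepro/Tier4/Common/KTypeProjectorAdjoint.lean`.  Mathlib +
`Common.CompactUnimodular` + `Common.KTypeProjector`; no literature.  Generic over a topological group `G` with a
subgroup `Γ` (= `G(k)`) and a fundamental domain `D` (= `D_G`) of its left action: L1's `RTF.Setting.inner S ψ φ`
and the L4 wall's `(Setting.ofAdelicData …).inner` are DEFINITIONALLY the displayed `∫ x in D, ψ x * conj (φ x) ∂μ`.

WHY (L4-p2 S13737 (b), (c); L4-p1 KTypeTransport «`hvan` … needs the projector identity»): with
`Tier4/Common/KTypeProjector.lean` ((a) `R(f)(e ψ) = R(f) ψ`) this completes the three items of the `(τ,K)`-projector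
fallback — (b) self-adjointness on `D_G`, (c) vanishing on the orthogonal complement.

* `isFundamentalDomain_mul_right_image` — the right translate `D z` of a fundamental domain of `Γ` is a fundamental
  domain (right-invariant `μ`; the generic form of CentralConsistency's `isFundamentalDomain_mul_right`);
* `setIntegral_eq_setIntegral_mul_right_of_invariant` — `∫_D F = ∫_D F(· z)` for left-`Γ`-invariant `F`;
* `integrable_restrict_prod_of_continuous` — a continuous integrand on `D × C` (`D` relatively compact, `C` compact)
  is integrable for `(μ.restrict D).prod ν`;
* **`setIntegral_kProj_mul_conj`** — `∫_D (e_{C,χ} ψ) conj φ = ∫_D ψ conj (e_{C,χ} φ)` for continuous left-`Γ`-invariant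
  `ψ, φ` (the ADJOINT identity: Fubini twice, the substitution `x ↦ x κ⁻¹` on the fundamental domain, inversion
  invariance of the Haar probability measure of the compact `C`);
* `ae_eq_zero_of_setIntegral_normSq_eq_zero_of_invariant` — a left-`Γ`-invariant continuous `g` with
  `∫_D ‖g‖² = 0` vanishes `μ`-a.e. on `G` (`IsFundamentalDomain.measure_zero_of_invariant`);
* **`kProj_ae_eq_zero_of_orthogonal`** — `⟨ψ, e_{C,χ} ψ⟩_D = 0 ⇒ e_{C,χ} ψ =ᵐ[μ] 0` (self-adjointness + idempotence:
  `⟨e ψ, e ψ⟩ = ⟨ψ, e e ψ⟩ = ⟨ψ, e ψ⟩ = 0`);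
* **`integral_mul_eq_zero_of_orthogonal`** — the L4-facing form: for a right-`(C, χ̄)`-equivariant test function `f`,
  `⟨ψ, e_{C,χ} ψ⟩_D = 0 ⇒ R(f) ψ = 0` (= `R(f)(e ψ)` by the projector identity, and `e ψ = 0` a.e.).

NOT here: that `e_{C,χ} ψ` lies in a given subspace `V` (so that `⟨ψ, e ψ⟩ = 0` follows from `ψ ⊥ V^{C,χ}`) — the
line's analysis of its own `V`.

Nothing here says anything about the status of the Hodge conjecture for CM abelian varieties, which is NOT proved
(HC_CM is NOT proved by anyone in this repository).
-/

set_option autoImplicit false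

noncomputable section

namespace Summit.Ventures.HodgeRepro.Tier4.Common

open MeasureTheory Measure Topology Set
open scoped ComplexConjugate Pointwise

section Translate

variable {G : Type*} [Group G] [TopologicalSpace G] [IsTopologicalGroup G] [MeasurableSpace G] [BorelSpace G]
  (Γ : Subgroup G) (μ : Measure G)

/-- **The right translate of a fundamental domain is a fundamental domain** (right-invariant `μ`): right
multiplication commutes with the left action of `Γ`. -/
theorem isFundamentalDomain_mul_right_image [μ.IsMulRightInvariant] {D : Set G} (hD : IsFundamentalDomain Γ D μ)
    (z : G) : IsFundamentalDomain Γ ((· * z) '' D) μ := by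
  have hq : Measure.QuasiMeasurePreserving (Equiv.mulRight z).symm μ μ := by
    rw [Equiv.mulRight_symm]
    exact (measurePreserving_mul_right μ z⁻¹).quasiMeasurePreserving
  have h := hD.image_of_equiv (Equiv.mulRight z) hq (Equiv.refl _) (fun γ x => by
    change (γ : G) * x * z = (γ : G) * (x * z)
    exact mul_assoc _ _ _)
  simpa only [Equiv.coe_mulRight] using h

/-- **`∫_D F = ∫_D F(· z)` for a left-`Γ`-invariant `F`** (`μ` bi-invariant, `Γ` countable): the integral over a
fundamental domain equals the integral over its right translate, which is the integral of the translated function. -/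
theorem setIntegral_eq_setIntegral_mul_right_of_invariant [Countable Γ] [μ.IsMulLeftInvariant]
    [μ.IsMulRightInvariant] {D : Set G} (hD : IsFundamentalDomain Γ D μ) (F : G → ℂ)
    (hF : ∀ (γ : Γ) (x : G), F ((γ : G) * x) = F x) (z : G) : ∫ x in D, F x ∂μ = ∫ x in D, F (x * z) ∂μ := by
  haveI : SMulInvariantMeasure Γ G μ :=
    ⟨fun γ s hs => Measure.IsMulLeftInvariant.smulInvariantMeasure.1 (γ : G) hs⟩
  have h1 : ∫ x in D, F x ∂μ = ∫ x in (· * z) '' D, F x ∂μ :=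
    hD.setIntegral_eq (isFundamentalDomain_mul_right_image Γ μ hD z) (fun γ x => hF γ x)
  rw [h1]
  exact (measurePreserving_mul_right μ z).setIntegral_image_emb (measurableEmbedding_mulRight z) F D

end Translate

section Adjoint

variable {G : Type*} [Group G] [TopologicalSpace G] [IsTopologicalGroup G] [MeasurableSpace G] [BorelSpace G]
  [SecondCountableTopology G] (C : Subgroup G) (ν : Measure C) (μ : Measure G)

omit [IsTopologicalGroup G] in
/-- A continuous integrand on `D × C` is integrable for `(μ.restrict D).prod ν` when `closure D` is compact and `C` is
a compact space (`μ` finite on compacts, `ν` finite). -/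
theorem integrable_restrict_prod_of_continuous [CompactSpace C] [IsFiniteMeasure ν] [SFinite μ]
    [IsFiniteMeasureOnCompacts μ] {D : Set G} (hDc : IsCompact (closure D)) {F : G → C → ℂ} (hF : Continuous (Function.uncurry F)) :
    Integrable (Function.uncurry F) ((μ.restrict D).prod ν) := by
  rw [Measure.restrict_prod_eq_prod_univ]
  refine IntegrableOn.mono_set ?_ (prod_mono subset_closure subset_rfl)
  exact hF.continuousOn.integrableOn_compact' (hDc.prod isCompact_univ)
    (isClosed_closure.measurableSet.prod MeasurableSet.univ)

/-- **THE ADJOINT IDENTITY** `⟨e_{C,χ} ψ, φ⟩_D = ⟨ψ, e_{C,χ} φ⟩_D`: for continuous left-`Γ`-invariant `ψ, φ`, a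
fundamental domain `D` of `Γ` with compact closure, `μ` a bi-invariant Haar measure (finite on compacts, s-finite),
`ν` a Haar probability measure on the compact subgroup `C`, and a unit-modulus multiplicative `χ` continuous on `C`:
`∫ x in D, e_{C,χ} ψ x * conj (φ x) ∂μ = ∫ x in D, ψ x * conj (e_{C,χ} φ x) ∂μ`.  Proof: Fubini, then for each `κ`
the substitution `x ↦ x κ⁻¹` on the fundamental domain (`setIntegral_eq_setIntegral_mul_right_of_invariant`), Fubini
back, and `∫_C χ(κ) φ(x κ⁻¹) dν = ∫_C conj χ(κ) φ(x κ) dν` by inversion invariance of `ν`. -/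
theorem setIntegral_kProj_mul_conj [CompactSpace C] [ν.IsHaarMeasure] [IsProbabilityMeasure ν] [SFinite μ]
    [μ.IsMulLeftInvariant] [μ.IsMulRightInvariant] [IsFiniteMeasureOnCompacts μ] {χ : G → ℂ}
    (hχc : Continuous fun κ : C => χ κ) (hχ : ∀ a ∈ C, ∀ b ∈ C, χ (a * b) = χ a * χ b)
    (hu : ∀ a ∈ C, ‖χ a‖ = 1) (Γ : Subgroup G) [Countable Γ] {D : Set G} (fd : IsFundamentalDomain Γ D μ)
    (hDc : IsCompact (closure D)) {ψ φ : G → ℂ} (hψ : Continuous ψ) (hφ : Continuous φ)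
    (hψΓ : ∀ (γ : Γ) (x : G), ψ ((γ : G) * x) = ψ x) (hφΓ : ∀ (γ : Γ) (x : G), φ ((γ : G) * x) = φ x) :
    ∫ x in D, kProj C ν χ ψ x * conj (φ x) ∂μ = ∫ x in D, ψ x * conj (kProj C ν χ φ x) ∂μ := by
  haveI := isInvInvariant_of_compactSpace ν
  have hcc : Continuous fun κ : C => conj (χ κ) := (Complex.continuous_conj).comp hχc
  -- integrability of the two product integrands
  have hint1 : Integrable (Function.uncurry fun (x : G) (κ : C) => conj (χ κ) * ψ (x * κ) * conj (φ x))
      ((μ.restrict D).prod ν) := by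
    refine integrable_restrict_prod_of_continuous C ν μ hDc ?_
    refine Continuous.mul (Continuous.mul ?_ ?_) ?_
    · exact hcc.comp continuous_snd
    · exact hψ.comp (continuous_fst.mul (continuous_subtype_val.comp continuous_snd))
    · exact (Complex.continuous_conj).comp (hφ.comp continuous_fst)
  have hint2 : Integrable (Function.uncurry fun (x : G) (κ : C) => ψ x * (conj (χ κ) * conj (φ (x * (κ : G)⁻¹))))
      ((μ.restrict D).prod ν) := by
    refine integrable_restrict_prod_of_continuous C ν μ hDc ?_
    refine Continuous.mul (hψ.comp continuous_fst) (Continuous.mul ?_ ?_)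
    · exact hcc.comp continuous_snd
    · exact (Complex.continuous_conj).comp
        (hφ.comp (continuous_fst.mul ((continuous_subtype_val.comp continuous_snd).inv)))
  -- for a fixed `κ`, the inner integral over `D`
  have hinner : ∀ κ : C, ∫ x in D, conj (χ κ) * ψ (x * κ) * conj (φ x) ∂μ
      = ∫ x in D, ψ x * (conj (χ κ) * conj (φ (x * (κ : G)⁻¹))) ∂μ := by
    intro κ
    have hsub : ∫ x in D, ψ x * conj (φ (x * (κ : G)⁻¹)) ∂μ = ∫ x in D, ψ (x * κ) * conj (φ x) ∂μ := by
      have h := setIntegral_eq_setIntegral_mul_right_of_invariant Γ μ fd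
        (fun x => ψ x * conj (φ (x * (κ : G)⁻¹))) (fun γ x => by
          show ψ ((γ : G) * x) * conj (φ ((γ : G) * x * (κ : G)⁻¹)) = ψ x * conj (φ (x * (κ : G)⁻¹))
          rw [hψΓ γ x, mul_assoc, hφΓ γ (x * (κ : G)⁻¹)]) (κ : G)
      rw [h]
      congr 1
      funext x
      show ψ (x * κ) * conj (φ (x * κ * (κ : G)⁻¹)) = ψ (x * κ) * conj (φ x)
      rw [mul_inv_cancel_right]
    calc ∫ x in D, conj (χ κ) * ψ (x * κ) * conj (φ x) ∂μ
        = conj (χ κ) * ∫ x in D, ψ (x * κ) * conj (φ x) ∂μ := by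
          rw [← integral_const_mul]
          congr 1
          funext x
          ring
      _ = conj (χ κ) * ∫ x in D, ψ x * conj (φ (x * (κ : G)⁻¹)) ∂μ := by rw [hsub]
      _ = ∫ x in D, ψ x * (conj (χ κ) * conj (φ (x * (κ : G)⁻¹))) ∂μ := by
          rw [← integral_const_mul]
          congr 1
          funext x
          ring
  -- for a fixed `x`, the integral over `C` is `ψ x · conj (e_{C,χ} φ x)`
  have hkx : ∀ x : G, ∫ κ : C, ψ x * (conj (χ κ) * conj (φ (x * (κ : G)⁻¹))) ∂ν
      = ψ x * conj (kProj C ν χ φ x) := by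
    intro x
    rw [integral_const_mul]
    congr 1
    have h1 : (fun κ : C => conj (χ κ) * conj (φ (x * (κ : G)⁻¹)))
        = fun κ : C => conj (χ κ * φ (x * (κ : G)⁻¹)) := by
      funext κ
      rw [map_mul]
    rw [h1, integral_conj]
    congr 1
    have h2 : ∫ κ : C, χ κ * φ (x * (κ : G)⁻¹) ∂ν = ∫ κ : C, χ (κ : G)⁻¹ * φ (x * κ) ∂ν := by
      have := integral_inv_eq_self (fun κ : C => χ ((κ⁻¹ : C) : G) * φ (x * κ)) ν
      simpa only [inv_inv, Subgroup.coe_inv] using this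
    rw [h2, kProj]
    congr 1
    funext κ
    rw [chi_inv C hχ hu κ.2, ← conj_eq_inv_of_norm_one (hu κ κ.2)]
  -- assembly
  calc ∫ x in D, kProj C ν χ ψ x * conj (φ x) ∂μ
      = ∫ x in D, ∫ κ : C, conj (χ κ) * ψ (x * κ) * conj (φ x) ∂ν ∂μ := by
        congr 1
        funext x
        rw [kProj, ← integral_mul_const]
    _ = ∫ κ : C, ∫ x in D, conj (χ κ) * ψ (x * κ) * conj (φ x) ∂μ ∂ν := integral_integral_swap hint1
    _ = ∫ κ : C, ∫ x in D, ψ x * (conj (χ κ) * conj (φ (x * (κ : G)⁻¹))) ∂μ ∂ν := by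
        congr 1
        funext κ
        exact hinner κ
    _ = ∫ x in D, ∫ κ : C, ψ x * (conj (χ κ) * conj (φ (x * (κ : G)⁻¹))) ∂ν ∂μ :=
        (integral_integral_swap hint2).symm
    _ = ∫ x in D, ψ x * conj (kProj C ν χ φ x) ∂μ := by
        congr 1
        funext x
        exact hkx x

end Adjoint

section Vanishing

variable {G : Type*} [Group G] [TopologicalSpace G] [IsTopologicalGroup G] [MeasurableSpace G] [BorelSpace G]

/-- **A left-`Γ`-invariant continuous function with `∫_D ‖g‖² = 0` vanishes `μ`-a.e. on `G`**: the set `{g ≠ 0}` is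
`Γ`-invariant and `μ`-null on the fundamental domain `D` (`closure D` compact, `μ` finite on compacts), hence null
(`IsFundamentalDomain.measure_zero_of_invariant`). -/
theorem ae_eq_zero_of_setIntegral_normSq_eq_zero_of_invariant (μ : Measure G) [IsFiniteMeasureOnCompacts μ]
    [μ.IsMulLeftInvariant] (Γ : Subgroup G) [Countable Γ] {D : Set G} (fd : IsFundamentalDomain Γ D μ)
    (hDc : IsCompact (closure D)) {g : G → ℂ} (hg : Continuous g) (hgΓ : ∀ (γ : Γ) (x : G), g ((γ : G) * x) = g x)
    (h0 : ∫ x in D, ‖g x‖ ^ 2 ∂μ = 0) : g =ᵐ[μ] 0 := by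
  haveI : SMulInvariantMeasure Γ G μ :=
    ⟨fun γ s hs => Measure.IsMulLeftInvariant.smulInvariantMeasure.1 (γ : G) hs⟩
  -- `‖g‖² = 0` a.e. on `D`
  have hint : Integrable (fun x => ‖g x‖ ^ 2) (μ.restrict D) := by
    have hc : Continuous fun x => ‖g x‖ ^ 2 := (hg.norm).pow 2
    have : IntegrableOn (fun x => ‖g x‖ ^ 2) (closure D) μ :=
      hc.continuousOn.integrableOn_compact' hDc isClosed_closure.measurableSet
    exact this.mono_set subset_closure
  have hae : (fun x => ‖g x‖ ^ 2) =ᵐ[μ.restrict D] 0 :=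
    (integral_eq_zero_iff_of_nonneg (fun x => by positivity) hint).1 h0
  -- hence `μ ({g ≠ 0} ∩ D) = 0`
  set t : Set G := {x | g x ≠ 0} with ht
  have htD : μ (t ∩ D) = 0 := by
    rw [measure_eq_zero_iff_ae_notMem]
    have hae' : ∀ᵐ x ∂μ, x ∈ D → ‖g x‖ ^ 2 = 0 := (ae_restrict_iff'₀ fd.nullMeasurableSet).1 hae
    filter_upwards [hae'] with x hx
    rintro ⟨hxt, hxD⟩
    have := hx hxD
    simp only [ht, mem_setOf_eq] at hxt
    exact hxt (by simpa using this)
  -- `t` is `Γ`-invariant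
  have hinv : ∀ γ : Γ, γ • t = t := by
    intro γ
    ext x
    rw [mem_smul_set_iff_inv_smul_mem]
    simp only [ht, mem_setOf_eq, Subgroup.smul_def, smul_eq_mul]
    rw [hgΓ γ⁻¹ x]
  have htμ : μ t = 0 := fd.measure_zero_of_invariant t hinv htD
  rw [Filter.EventuallyEq, ae_iff]
  simpa only [ht, Pi.zero_apply] using htμ

/-- `∫_D (e ψ) conj (e ψ) = 0` ⇒ `e ψ =ᵐ[μ] 0` (the pointwise identity `z conj z = ‖z‖²` and the lemma above). -/
theorem ae_eq_zero_of_setIntegral_mul_conj_self_eq_zero_of_invariant (μ : Measure G) [IsFiniteMeasureOnCompacts μ]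
    [μ.IsMulLeftInvariant] (Γ : Subgroup G) [Countable Γ] {D : Set G} (fd : IsFundamentalDomain Γ D μ)
    (hDc : IsCompact (closure D)) {g : G → ℂ} (hg : Continuous g) (hgΓ : ∀ (γ : Γ) (x : G), g ((γ : G) * x) = g x)
    (h0 : ∫ x in D, g x * conj (g x) ∂μ = 0) : g =ᵐ[μ] 0 := by
  refine ae_eq_zero_of_setIntegral_normSq_eq_zero_of_invariant μ Γ fd hDc hg hgΓ ?_
  have h1 : (fun x => g x * conj (g x)) = fun x => ((‖g x‖ ^ 2 : ℝ) : ℂ) := by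
    funext x
    rw [Complex.mul_conj']
    push_cast
    ring
  rw [h1, integral_complex_ofReal] at h0
  exact_mod_cast h0

end Vanishing

section Orthogonal

variable {G : Type*} [Group G] [TopologicalSpace G] [IsTopologicalGroup G] [MeasurableSpace G] [BorelSpace G]
  [SecondCountableTopology G] [LocallyCompactSpace G] (C : Subgroup G) (ν : Measure C) (μ : Measure G)

/-- **Vanishing on the orthogonal complement**: `⟨ψ, e_{C,χ} ψ⟩_D = 0 ⇒ e_{C,χ} ψ =ᵐ[μ] 0` — by the adjoint identity and
idempotence, `⟨e ψ, e ψ⟩_D = ⟨ψ, e (e ψ)⟩_D = ⟨ψ, e ψ⟩_D = 0`. -/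
theorem kProj_ae_eq_zero_of_orthogonal [CompactSpace C] [ν.IsHaarMeasure] [IsProbabilityMeasure ν] [SFinite μ]
    [μ.IsMulLeftInvariant] [μ.IsMulRightInvariant] [IsFiniteMeasureOnCompacts μ] {χ : G → ℂ}
    (hχc : Continuous fun κ : C => χ κ) (hχ : ∀ a ∈ C, ∀ b ∈ C, χ (a * b) = χ a * χ b)
    (hu : ∀ a ∈ C, ‖χ a‖ = 1) (Γ : Subgroup G) [Countable Γ] {D : Set G} (fd : IsFundamentalDomain Γ D μ)
    (hDc : IsCompact (closure D)) {ψ : G → ℂ} (hψ : Continuous ψ)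
    (hψΓ : ∀ (γ : Γ) (x : G), ψ ((γ : G) * x) = ψ x)
    (horth : ∫ x in D, ψ x * conj (kProj C ν χ ψ x) ∂μ = 0) : kProj C ν χ ψ =ᵐ[μ] 0 := by
  haveI := isMulRightInvariant_of_compactSpace ν
  have hcont : Continuous (kProj C ν χ ψ) := continuous_kProj C ν hχc hψ
  have hΓ : ∀ (γ : Γ) (x : G), kProj C ν χ ψ ((γ : G) * x) = kProj C ν χ ψ x := by
    intro γ x
    simp only [kProj, mul_assoc, hψΓ γ]
  refine ae_eq_zero_of_setIntegral_mul_conj_self_eq_zero_of_invariant μ Γ fd hDc hcont hΓ ?_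
  rw [setIntegral_kProj_mul_conj C ν μ hχc hχ hu Γ fd hDc hψ hcont hψΓ hΓ, kProj_kProj C ν hχ hu ψ]
  exact horth

/-- **THE L4-FACING FORM**: for a right-`(C, χ̄)`-equivariant test function `f` and a continuous left-`Γ`-invariant `ψ`
with `⟨ψ, e_{C,χ} ψ⟩_D = 0`, `R(f) ψ = 0`: `R(f) ψ = R(f)(e_{C,χ} ψ)` (projector identity) and `e_{C,χ} ψ = 0` a.e. -/
theorem integral_mul_eq_zero_of_orthogonal [CompactSpace C] [ν.IsHaarMeasure] [IsProbabilityMeasure ν] [SFinite μ]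
    [μ.IsMulLeftInvariant] [μ.IsMulRightInvariant] [IsFiniteMeasureOnCompacts μ] {χ : G → ℂ}
    (hχc : Continuous fun κ : C => χ κ) (hχ : ∀ a ∈ C, ∀ b ∈ C, χ (a * b) = χ a * χ b)
    (hu : ∀ a ∈ C, ‖χ a‖ = 1) (Γ : Subgroup G) [Countable Γ] {D : Set G} (fd : IsFundamentalDomain Γ D μ)
    (hDc : IsCompact (closure D)) {f ψ : G → ℂ} (hf : Continuous f) (hfc : HasCompactSupport f)
    (hfe : ∀ y, ∀ κ ∈ C, f (y * κ) = conj (χ κ) * f y) (hψ : Continuous ψ)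
    (hψΓ : ∀ (γ : Γ) (x : G), ψ ((γ : G) * x) = ψ x)
    (horth : ∫ x in D, ψ x * conj (kProj C ν χ ψ x) ∂μ = 0) (x : G) :
    ∫ y, f y * ψ (x * y) ∂μ = 0 := by
  rw [← integral_mul_kProj_eq C ν μ hχc hχ hu hf hfc hψ hfe x]
  have hae : kProj C ν χ ψ =ᵐ[μ] 0 :=
    kProj_ae_eq_zero_of_orthogonal C ν μ hχc hχ hu Γ fd hDc hψ hψΓ horth
  have hae' : (fun y => kProj C ν χ ψ (x * y)) =ᵐ[μ] fun _ => 0 :=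
    (measurePreserving_mul_left μ x).quasiMeasurePreserving.ae_eq_comp hae
  have : (fun y => f y * kProj C ν χ ψ (x * y)) =ᵐ[μ] fun _ => 0 := by
    filter_upwards [hae'] with y hy
    simp only [hy, mul_zero]
  rw [integral_congr_ae this, integral_zero]

end Orthogonal

end Summit.Ventures.HodgeRepro.Tier4.Common

end
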